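/-
Copyright (c) 2026 the pub-hodgecm-mathlib formalisation cell (harness21).  Prover seat hodgecm-mathlib-K2Liu-p09 (g7): Track B «K2-LIT»,
hLiu418 = stmt-HodgeConjecture-24832; LEAD F0P6-plan RULINGS M-158d «A7-val road (σ)» and σ19∕σ21 — `hne` organ, brick (N3a): a BIG-CELL PIECE with
compact indicator profile and non-zero period, cut out of any smooth Siegel section that does not vanish at `w_Δ`.
-/
import Summits.HodgeConjecture.HodgeConjecture.Theorems.K2LiuLocalSWBigCellCoordinate        -- ★ S1 F3c (`exists_bigCell_coordinate`; brings ★ `mem_bigCell_iff_isUnit_det_blkC`, `eq_of_siegel_mul_weylDelta_mul_eq`)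
import Summits.HodgeConjecture.HodgeConjecture.Theorems.K2LiuLocalSWBigCellTopology          -- ★ S1 F3c-B (`isOpen_bigCell`)
import Summits.HodgeConjecture.HodgeConjecture.Theorems.K2LiuA7NormalisedRegularitySetup     -- ★ B7-prep (`isClosed_unipDeltaLocal`)
import Summits.HodgeConjecture.HodgeConjecture.Theorems.K2LiuLocalPiTotallyDisconnected      -- ★ p860887 (`totallyDisconnectedSpace_localPi`)
import Literature.Topology.Algebra.CompactOpenSubgroupOfLocallyCompact                         -- ★ van Dantzig (`exists_isCompact_openSubgroup_subset`)
import Literature.NumberTheory.Automorphic.UnitaryGroupPureTensorEulerProduct                  -- ★ `UnitaryGroup.locallyCompactSpace_localPi`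
import HarnessLib

/-!
# Crux `HLiu418`, road `K2_Liu`, organ A7-val, `hne` organ brick (N3a): THE BIG-CELL PIECE WITNESS

Cell `hodgecm-mathlib`, crux item hLiu418 = `stmt-HodgeConjecture-24832`; squad K2 ∕ K2Liu; prover K2Liu-p09 (g7), organ lead A7-val.  THEOREMS ONLY; lane
`--supports stmt-HodgeConjecture-24832` (count-neutral helper).  RANK-GENERIC, every finite place, K2Lit currency `(F E c hcδ hδ hd v n hT₀ hT₀d hJD)`.

THE POINT (σ19-(Sp) input «a big-cell section with non-zero period»).  Given ANY smooth Siegel section `φ` of `I_v(s, χ_v)` with `φ(w_Δ) ≠ 0` (e.g. a local Siegel–Weil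
section, ★ `exists_ne_zero_swSectionLoc_weylDelta_mul_nElem_eq`) and a compact open `K₀ ≤ H_v`, the PIECE `f := φ · 𝟙_A`, `A := P_Δ · w_Δ · N₁`, `N₁ := N_Δ ∩ U_φ ∩ K₀`
(`U_φ` a level of `φ`), is again a smooth Siegel section of `I_v(s, χ_v)`; its profile `u ↦ f(w_Δ u)` is `φ(w_Δ) · 𝟙_{N₁}` — supported in the COMPACT `N₁` with period
`∫_{N_Δ} f(w_Δ u) du = φ(w_Δ) · νN(N₁) ≠ 0`.  Mechanism: `A = Ω ∩ ν⁻¹(U_φ ∩ K₀)` is OPEN (★ big cell `Ω` open, ★ continuous `N_Δ`-coordinate `ν`), contains the compact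
`w_Δ · N₁`, so `w_Δ N₁ · K″ ⊆ A` for a compact open subgroup `K″` (tube lemma + ★ van Dantzig), whence `A · K″ ⊆ A` and `f` has level `U_φ ∩ K″`; uniqueness of the
`N_Δ`-coordinate (★ `eq_of_siegel_mul_weylDelta_mul_eq`) reads the profile.
* **`exists_bigCell_piece`** — the piece with its four properties (Siegel, smooth, compact profile support, non-zero period) = the inputs `(C, hC, hsupp, hΛ)` of ★ V8g
  `hne_of_bigCell_witness` ∕ ★ V7b `value_bigCell_two_ne_zero`, for a section that need NOT lie in a single theta image.
HONEST LABEL.  `HC_CM` is proved only modulo the 7 printed citations (2 remaining named inputs: hLiu418 = `stmt-HodgeConjecture-24832`,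
h413 = `stmt-HodgeConjecture-24833`) until rung 0 closes.

## References
* [BernsteinZelevinsky1976] I. N. Bernstein, A. V. Zelevinsky, Russian Math. Surveys 31 (1976), §1.1, §1.5, §2.2 (pieces of induced representations on Bruhat cells).
* [Kudla1994] S. Kudla, Israel J. Math. 87 (1994), §3 (the big cell `P_Δ w_Δ N_Δ`).
* [KudlaSweet1997] S. Kudla, W. J. Sweet, Israel J. Math. 98 (1997), §1 (sections supported in the big cell).
* [Casselman1980] W. Casselman, Compositio Math. 40 (1980), §3.
-/

set_option autoImplicit false
set_option linter.dupNamespace false -- the mandated namespace repeats `HodgeConjecture.HodgeConjecture`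

noncomputable section

open scoped Classical Pointwise
open NumberField IsDedekindDomain MeasureTheory Topology
open Literature.NumberTheory.Automorphic Literature.NumberTheory.Automorphic.UnitaryGroup
open Literature.NumberTheory.GelbartRogawski1991.AdaptedBlocks
open Literature.NumberTheory.GelbartRogawski1991.UnitaryDualPair.LocalSplitting
open Literature.NumberTheory.K2Lit.LocalSiegelDoubled
open Summit.HodgeConjecture.HodgeConjecture.Cruxes.HLiu418.K2LiuLocalSWBigCellDecomposition
open Summit.HodgeConjecture.HodgeConjecture.Cruxes.HLiu418.K2LiuLocalSWBigCellCoordinate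
open Summit.HodgeConjecture.HodgeConjecture.Cruxes.HLiu418.K2LiuLocalSWBigCellTopology
open Summit.HodgeConjecture.HodgeConjecture.Cruxes.HLiu418.K2LiuA7NormalisedRegularitySetup
open Summit.HodgeConjecture.HodgeConjecture.Cruxes.HLiu418.K2LiuLocalPiTotallyDisconnected

namespace Summit.HodgeConjecture.HodgeConjecture.Cruxes.HLiu418.K2LiuBigCellPieceWitness

variable (F : Type) [Field F] [NumberField F] (E : Type) [Field E] [NumberField E] [Algebra F E]
  [Algebra.IsQuadraticExtension F E] (c : E ≃ₐ[F] E)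
  {δ : E} (hcδ : c δ = -δ) (hδ : δ ≠ 0) {d : F} (hd : δ * δ = algebraMap F E d) (v : HeightOneSpectrum (𝓞 F)) (n : ℕ)
  {T₀ : Matrix (Fin n) (Fin n) F} (hT₀ : T₀.IsSymm) (hT₀d : IsUnit T₀.det)
  {JD : Matrix (Fin (n + n)) (Fin (n + n)) E} (hJD : JD = (gramD F n T₀).map (algebraMap F E))
  (χv : ∀ w : PlacesOver E v, (w.1.adicCompletion E)ˣ →* ℂˣ) (s : ℂ)
  [MeasurableSpace (unipDeltaLocal F E c v n (JD := JD))] [BorelSpace (unipDeltaLocal F E c v n (JD := JD))]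
  (νN : Measure (unipDeltaLocal F E c v n (JD := JD))) [νN.IsHaarMeasure]

include hcδ hδ hd hT₀ hT₀d in
/-- **THE BIG-CELL PIECE WITNESS.**  For a compact open `K₀ ≤ H_v` and a smooth Siegel section `φ` of `I_v(s, χ_v)` with `φ(w_Δ) ≠ 0` there is a smooth Siegel section `f`
of `I_v(s, χ_v)` (the piece `φ · 𝟙_{P_Δ w_Δ N₁}`, `N₁ = N_Δ ∩ U_φ ∩ K₀`) whose big-cell profile `u ↦ f(w_Δ u)` vanishes off a COMPACT subset of `N_Δ(F_v)` and has NON-ZERO period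
`∫_{N_Δ} f(w_Δ u) dν_N(u) ≠ 0`. [cite: BernsteinZelevinsky1976, §1.5, §2.2] [cite: Kudla1994, §3] [cite: KudlaSweet1997, §1] -/
theorem exists_bigCell_piece (K₀ : Subgroup (UnitaryGroup.localPi E c (n + n) JD v))
    (hK₀ : IsCompact (K₀ : Set (UnitaryGroup.localPi E c (n + n) JD v)) ∧ IsOpen (K₀ : Set (UnitaryGroup.localPi E c (n + n) JD v)))
    (φ : UnitaryGroup.localPi E c (n + n) JD v → ℂ) (hφS : IsLocalSiegelSection F E c hcδ hδ hd v n hT₀ hJD χv s φ) (hφsm : IsSmooth F E c v n φ)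
    (hφw : φ (weylDelta F E c v n hJD) ≠ 0) :
    ∃ f : UnitaryGroup.localPi E c (n + n) JD v → ℂ, IsLocalSiegelSection F E c hcδ hδ hd v n hT₀ hJD χv s f ∧ IsSmooth F E c v n f ∧
      (∃ C : Set (unipDeltaLocal F E c v n (JD := JD)), IsCompact C ∧
        ∀ u : unipDeltaLocal F E c v n (JD := JD), u ∉ C → f (weylDelta F E c v n hJD * (u : UnitaryGroup.localPi E c (n + n) JD v)) = 0) ∧
      (∫ u : unipDeltaLocal F E c v n (JD := JD), f (weylDelta F E c v n hJD * (u : UnitaryGroup.localPi E c (n + n) JD v)) ∂νN) ≠ 0 := by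
  -- notation-free abbreviations
  obtain ⟨U, hU⟩ := hφsm
  obtain ⟨ν, hνc, hν⟩ := exists_bigCell_coordinate F E c hcδ hδ hd v n hT₀ hT₀d hJD
  have hΩ := isOpen_bigCell F E c hcδ hδ hd v n hT₀ hT₀d hJD
  -- the set `A = P_Δ · w_Δ · (N_Δ ∩ U ∩ K₀)`
  obtain ⟨A, hA⟩ : ∃ A : Set (UnitaryGroup.localPi E c (n + n) JD v), A = {g | ∃ p, IsSiegelDelta F E c hcδ hδ hd v n hT₀ hJD p ∧
      ∃ u ∈ unipDeltaLocal F E c v n (JD := JD), (u ∈ (U : Set (UnitaryGroup.localPi E c (n + n) JD v)) ∧ u ∈ (K₀ : Set (UnitaryGroup.localPi E c (n + n) JD v))) ∧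
        g = p * weylDelta F E c v n hJD * u} := ⟨_, rfl⟩
  -- `A` is left `P_Δ`-stable
  have hAP : ∀ p g, IsSiegelDelta F E c hcδ hδ hd v n hT₀ hJD p → (p * g ∈ A ↔ g ∈ A) := by
    intro p g hp
    rw [hA]
    constructor
    · rintro ⟨p', hp', u, hu, huUK, hpg⟩
      refine ⟨p⁻¹ * p', hp.inv.mul hp', u, hu, huUK, ?_⟩
      rw [← inv_mul_cancel_left p g, hpg]
      simp only [mul_assoc]
    · rintro ⟨p', hp', u, hu, huUK, rfl⟩
      exact ⟨p * p', hp.mul hp', u, hu, huUK, by rw [mul_assoc, mul_assoc, mul_assoc]⟩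
  -- reading the profile: `w_Δ u ∈ A ↔ u ∈ U ∩ K₀` for `u ∈ N_Δ`
  have hAw : ∀ u ∈ unipDeltaLocal F E c v n (JD := JD),
      (weylDelta F E c v n hJD * u ∈ A ↔ u ∈ (U : Set (UnitaryGroup.localPi E c (n + n) JD v)) ∧ u ∈ (K₀ : Set (UnitaryGroup.localPi E c (n + n) JD v))) := by
    intro u hu
    rw [hA]
    constructor
    · rintro ⟨p', hp', u', hu', hu'UK, h⟩
      have h1 : (1 : UnitaryGroup.localPi E c (n + n) JD v) * weylDelta F E c v n hJD * u = p' * weylDelta F E c v n hJD * u' := by rw [one_mul]; exact h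
      rw [eq_of_siegel_mul_weylDelta_mul_eq F E c hcδ hδ hd v n hT₀ hJD (isSiegelDelta_one F E c hcδ hδ hd v n hT₀ hJD) hp' hu hu' h1]
      exact hu'UK
    · intro huUK
      exact ⟨1, isSiegelDelta_one F E c hcδ hδ hd v n hT₀ hJD, u, hu, huUK, by rw [one_mul]⟩
  -- `A = Ω ∩ ν⁻¹(U ∩ K₀)` is open
  have hAeq : A = {g : UnitaryGroup.localPi E c (n + n) JD v | ∃ p, IsSiegelDelta F E c hcδ hδ hd v n hT₀ hJD p ∧
      ∃ u ∈ unipDeltaLocal F E c v n (JD := JD), g = p * weylDelta F E c v n hJD * u} ∩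
      ν ⁻¹' ((U : Set (UnitaryGroup.localPi E c (n + n) JD v)) ∩ K₀) := by
    ext g
    rw [hA]
    constructor
    · rintro ⟨p, hp, u, hu, huUK, rfl⟩
      exact ⟨⟨p, hp, u, hu, rfl⟩, by rw [Set.mem_preimage, hν p hp u hu]; exact huUK⟩
    · rintro ⟨⟨p, hp, u, hu, rfl⟩, hgν⟩
      rw [Set.mem_preimage, hν p hp u hu] at hgν
      exact ⟨p, hp, u, hu, hgν, rfl⟩
  have hAo : IsOpen A := by
    rw [hAeq]
    exact hνc.isOpen_inter_preimage hΩ (U.isOpen.inter hK₀.2)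
  -- the compact `w_Δ · N₁` inside `A`, and a compact open `K″` with `A · K″ ⊆ A`
  haveI : TotallyDisconnectedSpace (UnitaryGroup.localPi E c (n + n) JD v) := totallyDisconnectedSpace_localPi F E c (n + n) JD v
  haveI : LocallyCompactSpace (UnitaryGroup.localPi E c (n + n) JD v) := UnitaryGroup.locallyCompactSpace_localPi E (n + n) c JD v
  have hN₁c : IsCompact ((unipDeltaLocal F E c v n (JD := JD) : Set (UnitaryGroup.localPi E c (n + n) JD v)) ∩
      ((U : Set (UnitaryGroup.localPi E c (n + n) JD v)) ∩ K₀)) :=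
    hK₀.1.of_isClosed_subset ((isClosed_unipDeltaLocal F E c v n (JD := JD)).inter (U.isClosed.inter hK₀.1.isClosed)) (fun x hx => hx.2.2)
  have hCw : IsCompact ((fun u => weylDelta F E c v n hJD * u) '' ((unipDeltaLocal F E c v n (JD := JD) : Set (UnitaryGroup.localPi E c (n + n) JD v)) ∩
      ((U : Set (UnitaryGroup.localPi E c (n + n) JD v)) ∩ K₀))) := hN₁c.image (continuous_const.mul continuous_id)
  have hCwA : (fun u => weylDelta F E c v n hJD * u) '' ((unipDeltaLocal F E c v n (JD := JD) : Set (UnitaryGroup.localPi E c (n + n) JD v)) ∩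
      ((U : Set (UnitaryGroup.localPi E c (n + n) JD v)) ∩ K₀)) ⊆ A := by
    rintro _ ⟨u, ⟨hu, huUK⟩, rfl⟩
    exact (hAw u hu).2 huUK
  obtain ⟨V, hV, hCV⟩ := compact_open_separated_mul_right hCw hAo hCwA
  obtain ⟨K'', -, hK''V⟩ := Literature.Topology.Algebra.exists_isCompact_openSubgroup_subset (G := UnitaryGroup.localPi E c (n + n) JD v) hV
  have hAK : ∀ g ∈ A, ∀ k ∈ (K'' : Subgroup (UnitaryGroup.localPi E c (n + n) JD v)), g * k ∈ A := by
    intro g hg k hk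
    rw [hA] at hg
    obtain ⟨p, hp, u, hu, huUK, rfl⟩ := hg
    have hmem : weylDelta F E c v n hJD * u * k ∈ A :=
      hCV (Set.mul_mem_mul ⟨u, ⟨hu, huUK⟩, rfl⟩ (hK''V hk))
    rw [mul_assoc p, mul_assoc p, hAP p _ hp]
    rw [mul_assoc] at hmem ⊢
    exact hmem
  have hAK' : ∀ g, ∀ k ∈ (K'' : Subgroup (UnitaryGroup.localPi E c (n + n) JD v)), (g * k ∈ A ↔ g ∈ A) := by
    intro g k hk
    refine ⟨fun h => ?_, fun h => hAK g h k hk⟩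
    have h' := hAK _ h k⁻¹ (K''.inv_mem hk)
    rwa [mul_inv_cancel_right] at h'
  -- the piece
  refine ⟨fun g => if g ∈ A then φ g else 0, ?_, ?_, ?_, ?_⟩
  · -- Siegel law
    intro p hp g
    show (if p * g ∈ A then φ (p * g) else 0) = localSiegelCharacter F E c v n χv s p * (if g ∈ A then φ g else 0)
    rw [hAP p g hp, hφS p hp g]
    split_ifs
    · rfl
    · rw [mul_zero]
  · -- smoothness, level `U ⊓ K″`
    refine ⟨U ⊓ K'', fun g k hk => ?_⟩
    have hkU : k ∈ (U : Subgroup (UnitaryGroup.localPi E c (n + n) JD v)) := (Subgroup.mem_inf.1 hk).1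
    have hkK : k ∈ (K'' : Subgroup (UnitaryGroup.localPi E c (n + n) JD v)) := (Subgroup.mem_inf.1 hk).2
    show (if g * k ∈ A then φ (g * k) else 0) = if g ∈ A then φ g else 0
    rw [hAK' g k hkK, hU g k hkU]
  · -- compact support of the profile
    refine ⟨Subtype.val ⁻¹' ((U : Set (UnitaryGroup.localPi E c (n + n) JD v)) ∩ K₀), ?_, fun u hu => ?_⟩
    · exact (isClosed_unipDeltaLocal F E c v n (JD := JD)).isClosedEmbedding_subtypeVal.isCompact_preimage (hK₀.1.inter_left U.isClosed)
    · show (if weylDelta F E c v n hJD * (u : UnitaryGroup.localPi E c (n + n) JD v) ∈ A then φ _ else 0) = 0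
      rw [if_neg]
      rw [hAw _ u.2]
      exact hu
  · -- the period `φ(w_Δ) · νN(N₁) ≠ 0`
    have hprof : (fun u : unipDeltaLocal F E c v n (JD := JD) => (if weylDelta F E c v n hJD * (u : UnitaryGroup.localPi E c (n + n) JD v) ∈ A
        then φ (weylDelta F E c v n hJD * (u : UnitaryGroup.localPi E c (n + n) JD v)) else 0)) =
        (Subtype.val ⁻¹' ((U : Set (UnitaryGroup.localPi E c (n + n) JD v)) ∩ K₀)).indicator fun _ => φ (weylDelta F E c v n hJD) := by
      funext u
      by_cases hu : (u : UnitaryGroup.localPi E c (n + n) JD v) ∈ (U : Set (UnitaryGroup.localPi E c (n + n) JD v)) ∧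
          (u : UnitaryGroup.localPi E c (n + n) JD v) ∈ (K₀ : Set (UnitaryGroup.localPi E c (n + n) JD v))
      · rw [if_pos ((hAw _ u.2).2 hu), Set.indicator_of_mem (show u ∈ Subtype.val ⁻¹' ((U : Set (UnitaryGroup.localPi E c (n + n) JD v)) ∩ K₀) from hu),
          hU _ _ hu.1]
      · rw [if_neg (fun h => hu ((hAw _ u.2).1 h)), Set.indicator_of_notMem (show u ∉ Subtype.val ⁻¹' ((U : Set (UnitaryGroup.localPi E c (n + n) JD v)) ∩ K₀) from hu)]
    have hopen : IsOpen (Subtype.val ⁻¹' ((U : Set (UnitaryGroup.localPi E c (n + n) JD v)) ∩ K₀) : Set (unipDeltaLocal F E c v n (JD := JD))) :=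
      (U.isOpen.inter hK₀.2).preimage continuous_subtype_val
    have hcpt : IsCompact (Subtype.val ⁻¹' ((U : Set (UnitaryGroup.localPi E c (n + n) JD v)) ∩ K₀) : Set (unipDeltaLocal F E c v n (JD := JD))) :=
      (isClosed_unipDeltaLocal F E c v n (JD := JD)).isClosedEmbedding_subtypeVal.isCompact_preimage (hK₀.1.inter_left U.isClosed)
    have hne : (Subtype.val ⁻¹' ((U : Set (UnitaryGroup.localPi E c (n + n) JD v)) ∩ K₀) : Set (unipDeltaLocal F E c v n (JD := JD))).Nonempty :=
      ⟨1, ⟨U.one_mem, K₀.one_mem⟩⟩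
    show (∫ u : unipDeltaLocal F E c v n (JD := JD), (if weylDelta F E c v n hJD * (u : UnitaryGroup.localPi E c (n + n) JD v) ∈ A
        then φ (weylDelta F E c v n hJD * (u : UnitaryGroup.localPi E c (n + n) JD v)) else 0) ∂νN) ≠ 0
    rw [hprof, integral_indicator_const _ hopen.measurableSet, Complex.real_smul]
    refine mul_ne_zero ?_ hφw
    rw [Complex.ofReal_ne_zero, measureReal_def]
    exact (ENNReal.toReal_pos (hopen.measure_pos νN hne).ne' hcpt.measure_lt_top.ne).ne'

end Summit.HodgeConjecture.HodgeConjecture.Cruxes.HLiu418.K2LiuBigCellPieceWitness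

end
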